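import Summits.Ventures.QEC.CircuitDistance.ETowerOrbit
import HarnessLib

/-!
# P3-PORT STEP 2 (E-fold tower): the in-kernel WEIGHT-ENUMERATOR DP and its specification (CARD-7 §5 S6 (b), PORT-SPEC S6 (b))
# (cell `qec`, experiment CDX, seat qec-cdx-type-1; after idea-1's `OneBaseX_b` prototype, re-packed for an exact spec)

`#X_w` = the number of words `u < 2^n` with column syndrome `⊕_{i ∈ u} col i = 0` and weight `w` is computed by a DP over the
columns: a complete binary tree of depth `d` (≥ the column width) indexed by the syndrome `σ`, each leaf holding the generating
polynomial `Σ_j #{u : syn u = σ, |u| = j}·B^j` packed in base `B = 2^64` and truncated at degree `W` (exact: weights only grow,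
and every count is `≤ 2^n < B` for `n < 64`).  One column `c` maps leaf `σ ↦ leaf σ + B · leaf (σ ⊕ c)` (`pairup`, one tree
recursion).  `dpCount_eq_card`: for `w ≤ W`, `dpCount col n d W w = #(Xw' col n w)`; `Xw'` is `ETowerOrbit.Xw` read with a
general `n` (`Xw_eq_Xw'`).  Generic; no data; no `native_decide`.
-/

namespace Summit.Ventures.QEC.CircuitDistance.ETower

open Summit.Ventures.QEC.Census Summit.Ventures.QEC.Census.Fold Finset

/-! ## The DP -/

/-- Complete binary tree with numeral leaves. -/
inductive DT where
  | lf (x : ℕ) : DT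
  | nd (l r : DT) : DT

/-- Leaf at path `σ` (bits `d−1 … 0`, bit `i` chooses the right child at height `i+1`). -/
def DT.get : DT → ℕ → ℕ → ℕ
  | .lf x, _, _ => x
  | .nd _ _, 0, _ => 0
  | .nd l r, d + 1, σ => if σ.testBit d then r.get d σ else l.get d σ

/-- Full tree of depth `d`. -/
def DT.WF : DT → ℕ → Prop
  | .lf _, d => d = 0
  | .nd l r, d => ∃ d', d = d' + 1 ∧ l.WF d' ∧ r.WF d'

/-- Initial table: `1` at `σ = 0`, `0` elsewhere (`b` = «path so far is all zeros»). -/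
def dtInit : ℕ → Bool → DT
  | 0, b => .lf (if b then 1 else 0)
  | d + 1, b => .nd (dtInit d b) (dtInit d false)

/-- One column `c`: the tree `σ ↦ (A σ + B · T (σ ⊕ c)) mod M`. -/
def pairup (B M c : ℕ) : ℕ → DT → DT → DT
  | 0, .lf a, .lf b => .lf ((a + B * b) % M)
  | d + 1, .nd a0 a1, .nd b0 b1 =>
    if c.testBit d then .nd (pairup B M c d a0 b1) (pairup B M c d a1 b0)
    else .nd (pairup B M c d a0 b0) (pairup B M c d a1 b1)
  | _, _, _ => .lf 0

/-- The DP over a column list. -/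
def dpRun (B M d : ℕ) (cols : List ℕ) : DT := cols.foldl (fun T c => pairup B M c d T T) (dtInit d true)

/-- Base-`B` digit `j`. -/
def field (B x j : ℕ) : ℕ := x / B ^ j % B

/-- THE COUNT: digit `w` of leaf `0` after all `n` columns (`B = 2^64`, truncation at degree `W`). -/
def dpCount (col : ℕ → ℕ) (n d W w : ℕ) : ℕ :=
  field (2 ^ 64) ((dpRun (2 ^ 64) ((2 ^ 64) ^ (W + 1)) d ((List.range n).map col)).get d 0) w

/-- The counted sets, general word length. -/
def Xw' (col : ℕ → ℕ) (n w : ℕ) : Finset ℕ := (range (2 ^ n)).filter fun s => lin col n 0 s = 0 ∧ popc n s = w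

/-- `ETowerOrbit.Xw` is `Xw'` at `n = nb·ls·ms`. -/
theorem Xw_eq_Xw' (col : ℕ → ℕ) (ls ms nb w : ℕ) : Xw col ls ms nb w = Xw' col (nb * (ls * ms)) w := rfl

/-! ## Tree semantics -/

/-- `dtInit` is full. -/
theorem dtInit_wf : ∀ (d : ℕ) (b : Bool), (dtInit d b).WF d
  | 0, _ => rfl
  | d + 1, b => ⟨d, rfl, dtInit_wf d b, dtInit_wf d false⟩

/-- Leaves of `dtInit`. -/
theorem get_dtInit : ∀ (d : ℕ) (b : Bool) (σ : ℕ),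
    (dtInit d b).get d σ = if b = true ∧ (∀ i, i < d → σ.testBit i = false) then 1 else 0
  | 0, b, σ => by unfold dtInit DT.get; simp
  | d + 1, b, σ => by
    unfold dtInit DT.get
    by_cases hb : σ.testBit d
    · rw [if_pos hb, get_dtInit d false σ]
      have h1 : ¬ (false = true ∧ ∀ i, i < d → σ.testBit i = false) := fun h => Bool.false_ne_true h.1
      have h2 : ¬ (b = true ∧ ∀ i, i < d + 1 → σ.testBit i = false) := fun h => by
        have := h.2 d (Nat.lt_succ_self d); rw [hb] at this; exact Bool.noConfusion this
      rw [if_neg h1, if_neg h2]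
    · rw [if_neg hb, get_dtInit d b σ]
      have : (b = true ∧ ∀ i, i < d → σ.testBit i = false) ↔ (b = true ∧ ∀ i, i < d + 1 → σ.testBit i = false) := by
        refine and_congr_right fun _ => ⟨fun h i hi => ?_, fun h i hi => h i (Nat.lt_succ_of_lt hi)⟩
        rcases Nat.lt_succ_iff_lt_or_eq.1 hi with hi | rfl
        · exact h i hi
        · simpa using hb
      simp only [this]

/-- Below `2^d`, «all low `d` bits clear» means `= 0`. -/
theorem lowBits_clear_iff {d σ : ℕ} (hσ : σ < 2 ^ d) : (∀ i, i < d → σ.testBit i = false) ↔ σ = 0 := by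
  constructor
  · intro h
    apply Nat.eq_of_testBit_eq; intro i
    rw [Nat.zero_testBit]
    by_cases hi : i < d
    · exact h i hi
    · exact Nat.testBit_lt_two_pow (lt_of_lt_of_le hσ (Nat.pow_le_pow_right (by norm_num) (not_lt.1 hi)))
  · rintro rfl i _; exact Nat.zero_testBit i

/-- `pairup` keeps fullness. -/
theorem pairup_wf (B M c : ℕ) : ∀ (d : ℕ) (A T : DT), A.WF d → T.WF d → (pairup B M c d A T).WF d := by
  intro d
  induction d with
  | zero =>
    intro A T hA hT
    cases A with
    | lf a =>
      cases T with
      | lf b => rfl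
      | nd l r => simp [DT.WF] at hT
    | nd l r => simp [DT.WF] at hA
  | succ d ih =>
    intro A T hA hT
    cases A with
    | lf a => simp [DT.WF] at hA
    | nd a0 a1 =>
      cases T with
      | lf b => simp [DT.WF] at hT
      | nd b0 b1 =>
        simp only [DT.WF, Nat.add_right_cancel_iff, exists_eq_left'] at hA hT
        unfold pairup
        split
        · exact ⟨d, rfl, ih a0 b1 hA.1 hT.2, ih a1 b0 hA.2 hT.1⟩
        · exact ⟨d, rfl, ih a0 b0 hA.1 hT.1, ih a1 b1 hA.2 hT.2⟩

/-- `get` only reads the low `d` bits of the path. -/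
theorem get_congr : ∀ (T : DT) (d σ τ : ℕ), (∀ i, i < d → σ.testBit i = τ.testBit i) → T.get d σ = T.get d τ
  | .lf _, _, _, _, _ => rfl
  | .nd _ _, 0, _, _, _ => rfl
  | .nd l r, d + 1, σ, τ, h => by
    unfold DT.get
    rw [h d (Nat.lt_succ_self d)]
    split
    · exact get_congr r d σ τ fun i hi => h i (Nat.lt_succ_of_lt hi)
    · exact get_congr l d σ τ fun i hi => h i (Nat.lt_succ_of_lt hi)

/-- Leaves of `pairup`: `σ ↦ (A σ + B · T (σ ⊕ c)) mod M`. -/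
theorem get_pairup (B M c : ℕ) :
    ∀ (d : ℕ) (A T : DT), A.WF d → T.WF d → ∀ σ, (pairup B M c d A T).get d σ = (A.get d σ + B * T.get d (σ ^^^ c)) % M := by
  intro d
  induction d with
  | zero =>
    intro A T hA hT σ
    cases A with
    | lf a =>
      cases T with
      | lf b => rfl
      | nd l r => simp [DT.WF] at hT
    | nd l r => simp [DT.WF] at hA
  | succ d ih =>
    intro A T hA hT σ
    cases A with
    | lf a => simp [DT.WF] at hA
    | nd a0 a1 =>
      cases T with
      | lf b => simp [DT.WF] at hT
      | nd b0 b1 =>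
        simp only [DT.WF, Nat.add_right_cancel_iff, exists_eq_left'] at hA hT
        have hx : (σ ^^^ c).testBit d = (σ.testBit d ^^ c.testBit d) := Nat.testBit_xor _ _ _
        unfold pairup
        by_cases hc : c.testBit d <;> by_cases hs : σ.testBit d
        · rw [if_pos hc]; unfold DT.get; rw [if_pos hs, hx, hs, hc, ih a1 b0 hA.2 hT.1]; rfl
        · rw [if_pos hc]; unfold DT.get; rw [if_neg hs, hx, hc, ih a0 b1 hA.1 hT.2]; simp [hs]
        · rw [if_neg hc]; unfold DT.get; rw [if_pos hs, hx, hs, ih a1 b1 hA.2 hT.2]; simp [hc]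
        · rw [if_neg hc]; unfold DT.get; rw [if_neg hs, hx, ih a0 b0 hA.1 hT.1]; simp [hs, hc]

/-! ## The abstract count -/

/-- Count by recursion on the reversed column list: `cntR rc σ j` for `rc = cols.reverse`. -/
def cntR : List ℕ → ℕ → ℕ → ℕ
  | [], σ, j => if σ = 0 ∧ j = 0 then 1 else 0
  | c :: rc, σ, j => cntR rc σ j + (if j = 0 then 0 else cntR rc (σ ^^^ c) (j - 1))

/-- The packed polynomial of a leaf: `Σ_{j ≤ W} cntR rc σ j · B^j`. -/
def poly (B W : ℕ) (rc : List ℕ) (σ : ℕ) : ℕ := ∑ j ∈ range (W + 1), cntR rc σ j * B ^ j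

/-- One column on the packed polynomials, modulo `B^(W+1)`. -/
theorem poly_cons (B W : ℕ) (rc : List ℕ) (c σ : ℕ) :
    poly B W (c :: rc) σ % B ^ (W + 1) = (poly B W rc σ + B * poly B W rc (σ ^^^ c)) % B ^ (W + 1) := by
  unfold poly
  have h1 : ∑ j ∈ range (W + 1), cntR (c :: rc) σ j * B ^ j =
      ∑ j ∈ range (W + 1), cntR rc σ j * B ^ j + ∑ j ∈ range (W + 1), (if j = 0 then 0 else cntR rc (σ ^^^ c) (j - 1)) * B ^ j := by
    rw [← sum_add_distrib]; refine sum_congr rfl fun j _ => ?_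
    rw [show cntR (c :: rc) σ j = cntR rc σ j + (if j = 0 then 0 else cntR rc (σ ^^^ c) (j - 1)) from rfl, add_mul]
  -- the shifted sum: Σ_{j=1}^{W} cnt (j-1) B^j = B · Σ_{j' < W} cnt j' B^j' = B·(poly − cnt W B^W)
  have h2 : ∑ j ∈ range (W + 1), (if j = 0 then 0 else cntR rc (σ ^^^ c) (j - 1)) * B ^ j =
      B * ∑ j ∈ range W, cntR rc (σ ^^^ c) j * B ^ j := by
    rw [sum_range_succ', mul_sum]
    simp only [if_true, zero_mul, add_zero, Nat.add_sub_cancel, Nat.succ_ne_zero, if_false, pow_succ]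
    refine sum_congr rfl fun j _ => by ring
  have h3 : ∑ j ∈ range (W + 1), cntR rc (σ ^^^ c) j * B ^ j =
      ∑ j ∈ range W, cntR rc (σ ^^^ c) j * B ^ j + cntR rc (σ ^^^ c) W * B ^ W := sum_range_succ _ _
  rw [h1, h2, h3, mul_add, ← add_assoc, show B * (cntR rc (σ ^^^ c) W * B ^ W) = cntR rc (σ ^^^ c) W * B ^ (W + 1) by ring,
    Nat.add_mul_mod_self_right]

/-- The initial polynomial. -/
theorem poly_nil (B W σ : ℕ) : poly B W [] σ = if σ = 0 then 1 else 0 := by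
  unfold poly
  rw [sum_range_succ']
  have hz : ∑ j ∈ range W, cntR [] σ (j + 1) * B ^ (j + 1) = 0 :=
    sum_eq_zero fun j _ => by rw [show cntR [] σ (j + 1) = 0 from by unfold cntR; simp]; simp
  rw [hz, zero_add, pow_zero, mul_one]
  unfold cntR; by_cases h : σ = 0 <;> simp [h]

/-- Modular bookkeeping of one DP step. -/
theorem step_mod (a b B M : ℕ) : (a % M + B * (b % M)) % M = (a + B * b) % M :=
  Nat.ModEq.add (Nat.mod_modEq a M) (Nat.ModEq.mul_left B (Nat.mod_modEq b M))

/-- **DP INVARIANT**: after the columns `cols`, leaf `σ` = `poly (cols.reverse) σ mod B^(W+1)`. -/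
theorem get_dpRun {B : ℕ} (hB : 2 ≤ B) (W d : ℕ) : ∀ (cols : List ℕ) (σ : ℕ), (∀ c ∈ cols, c < 2 ^ d) →
    (dpRun B (B ^ (W + 1)) d cols).WF d ∧
      (σ < 2 ^ d → (dpRun B (B ^ (W + 1)) d cols).get d σ = poly B W cols.reverse σ % B ^ (W + 1)) := by
  intro cols
  induction cols using List.reverseRecOn with
  | nil =>
    intro σ _
    refine ⟨dtInit_wf d true, fun hσ => ?_⟩
    unfold dpRun
    rw [List.foldl_nil, List.reverse_nil, get_dtInit, poly_nil]
    have hM : 1 < B ^ (W + 1) := Nat.one_lt_pow (Nat.succ_ne_zero W) hB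
    by_cases h0 : σ = 0
    · subst h0
      rw [if_pos ⟨rfl, fun i _ => Nat.zero_testBit i⟩, if_pos rfl, Nat.mod_eq_of_lt hM]
    · rw [if_neg (fun h => h0 ((lowBits_clear_iff hσ).1 h.2)), if_neg h0, Nat.zero_mod]
  | append_singleton cols c ih =>
    intro σ hcols
    have hc : c < 2 ^ d := hcols c (by simp)
    have hcols' : ∀ c' ∈ cols, c' < 2 ^ d := fun c' h => hcols c' (by simp [h])
    have hwf := (ih 0 hcols').1
    unfold dpRun at ih hwf ⊢
    rw [List.foldl_append, List.foldl_cons, List.foldl_nil]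
    refine ⟨pairup_wf _ _ _ _ _ _ hwf hwf, fun hσ => ?_⟩
    rw [get_pairup _ _ _ _ _ _ hwf hwf, (ih σ hcols').2 hσ, (ih (σ ^^^ c) hcols').2 (Nat.xor_lt_two_pow hσ hc),
      List.reverse_append, List.reverse_singleton, List.singleton_append, poly_cons, step_mod]

/-! ## The abstract count is the cardinality -/

/-- Syndrome of `u` over the column list (bit `i` of `u` selects `cols[i]`). -/
def lsyn (cols : List ℕ) (u : ℕ) : ℕ := lin (fun i => cols.getD i 0) cols.length 0 u

/-- Appending a column: the syndrome splits at bit `k = |cols|`. -/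
theorem lsyn_append_singleton (cols : List ℕ) (c x : ℕ) :
    lsyn (cols ++ [c]) x = lsyn cols (x % 2 ^ cols.length) ^^^ (if x / 2 ^ cols.length % 2 = 1 then c else 0) := by
  unfold lsyn
  rw [List.length_append, List.length_singleton, lin_split _ cols.length 1 0 x, lin_succ, lin_zero_width, Nat.xor_zero,
    Nat.zero_add, List.getD_append_right _ _ _ _ (le_refl _), Nat.sub_self, List.getD_cons_zero]
  congr 1
  exact lin_congr (i0 := 0) (fun i hi => by rw [Nat.zero_add, List.getD_append _ _ _ _ hi]) _

/-- `popc 1 y = y % 2`. -/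
theorem popc_one (y : ℕ) : popc 1 y = y % 2 := by rw [popc_succ]; rfl

/-- `cntR cols.reverse σ j` counts the words below `2^|cols|` with syndrome `σ` and weight `j`. -/
theorem cntR_eq_card : ∀ (cols : List ℕ) (σ j : ℕ),
    cntR cols.reverse σ j = #((range (2 ^ cols.length)).filter fun u => lsyn cols u = σ ∧ popc cols.length u = j) := by
  intro cols
  induction cols using List.reverseRecOn with
  | nil =>
    intro σ j
    simp only [List.reverse_nil, cntR, List.length_nil, pow_zero]
    have h0 : ∀ u, lsyn [] u = 0 := fun u => rfl
    by_cases h : σ = 0 ∧ j = 0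
    · rw [if_pos h]
      have : (range 1).filter (fun u => lsyn [] u = σ ∧ popc 0 u = j) = {0} := by
        ext u; simp only [mem_filter, mem_range, Nat.lt_one_iff, mem_singleton, h0, popc, h.1, h.2, and_self, and_true]
      rw [this]; rfl
    · rw [if_neg h]
      symm; rw [card_eq_zero, filter_eq_empty_iff]
      intro u _ ⟨h1, h2⟩
      exact h ⟨by rw [← h1, h0], by simpa [popc] using h2.symm⟩
  | append_singleton cols c ih =>
    intro σ j
    rw [List.reverse_append, List.reverse_singleton, List.singleton_append, cntR, ih, ih, List.length_append,
      List.length_singleton, card_filter, card_filter, card_filter, pow_succ, mul_two, sum_range_add]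
    have hk2 : 0 < 2 ^ cols.length := Nat.two_pow_pos _
    congr 1
    · refine sum_congr rfl fun u hu => ?_
      rw [mem_range] at hu
      have e1 : lsyn (cols ++ [c]) u = lsyn cols u := by
        rw [lsyn_append_singleton, Nat.mod_eq_of_lt hu, Nat.div_eq_of_lt hu]; simp
      have e2 : popc (cols.length + 1) u = popc cols.length u := by
        rw [popc_split cols.length 1 u, Nat.mod_eq_of_lt hu, Nat.div_eq_of_lt hu, popc_one, Nat.zero_mod, Nat.add_zero]
      rw [e1, e2]
    · have hmod : ∀ u, u < 2 ^ cols.length → (2 ^ cols.length + u) % 2 ^ cols.length = u := fun u hu => by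
        rw [Nat.add_mod, Nat.mod_self, Nat.zero_add, Nat.mod_mod, Nat.mod_eq_of_lt hu]
      have hdiv : ∀ u, u < 2 ^ cols.length → (2 ^ cols.length + u) / 2 ^ cols.length = 1 := fun u hu => by
        rw [Nat.add_div_of_dvd_right (dvd_refl _), Nat.div_self hk2, Nat.div_eq_of_lt hu]
      by_cases hj : j = 0
      · subst hj
        rw [if_pos rfl]
        symm
        refine sum_eq_zero fun u hu => ?_
        rw [mem_range] at hu
        have e2 : popc (cols.length + 1) (2 ^ cols.length + u) = popc cols.length u + 1 := by
          rw [popc_split cols.length 1, hmod u hu, hdiv u hu, popc_one]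
        rw [e2]; simp
      · rw [if_neg hj]
        refine sum_congr rfl fun u hu => ?_
        rw [mem_range] at hu
        have e1 : lsyn (cols ++ [c]) (2 ^ cols.length + u) = lsyn cols u ^^^ c := by
          rw [lsyn_append_singleton, hmod u hu, hdiv u hu, if_pos (show 1 % 2 = 1 from rfl)]
        have e2 : popc (cols.length + 1) (2 ^ cols.length + u) = popc cols.length u + 1 := by
          rw [popc_split cols.length 1, hmod u hu, hdiv u hu, popc_one]
        have e3 : (lsyn cols u ^^^ c = σ) ↔ (lsyn cols u = σ ^^^ c) := by
          constructor
          · intro h; rw [← h, Nat.xor_assoc, Nat.xor_self, Nat.xor_zero]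
          · intro h; rw [h, Nat.xor_assoc, Nat.xor_self, Nat.xor_zero]
        have e4 : (popc cols.length u + 1 = j) ↔ (popc cols.length u = j - 1) := by omega
        simp only [e1, e2, e3, e4]

/-- `lsyn` over `(range n).map col` is `lin col n 0`. -/
theorem lsyn_range_map (col : ℕ → ℕ) (n u : ℕ) : lsyn ((List.range n).map col) u = lin col n 0 u := by
  unfold lsyn
  rw [List.length_map, List.length_range]
  exact lin_congr (i0 := 0) (fun i hi => by
    rw [Nat.zero_add, List.getD_eq_getElem?_getD, List.getElem?_map, List.getElem?_range hi, Option.map_some,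
      Option.getD_some]) u

/-! ## Digits of the packed polynomial -/

/-- A base-`B` polynomial with digits `< B` is below `B^(number of digits)`. -/
theorem poly_lt {B : ℕ} (hB : 0 < B) (f : ℕ → ℕ) (hf : ∀ j, f j < B) : ∀ n, ∑ j ∈ range n, f j * B ^ j < B ^ n
  | 0 => by simp
  | n + 1 => by
    rw [sum_range_succ, pow_succ]
    have h1 := poly_lt hB f hf n
    have h2 : f n * B ^ n ≤ (B - 1) * B ^ n := Nat.mul_le_mul_right _ (by have := hf n; omega)
    have h3 : B ^ n + (B - 1) * B ^ n = B ^ n * B := by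
      rcases B with _ | B
      · omega
      · rw [Nat.add_sub_cancel]; ring
    calc ∑ j ∈ range n, f j * B ^ j + f n * B ^ n < B ^ n + (B - 1) * B ^ n := by omega
      _ = B ^ n * B := h3

/-- Digit extraction from a base-`B` polynomial with digits `< B`. -/
theorem field_poly {B : ℕ} (hB : 0 < B) (f : ℕ → ℕ) (hf : ∀ j, f j < B) {n w : ℕ} (hw : w < n) :
    field B (∑ j ∈ range n, f j * B ^ j) w = f w := by
  unfold field
  obtain ⟨m, rfl⟩ : ∃ m, n = w + 1 + m := ⟨n - (w + 1), by omega⟩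
  rw [sum_range_add, sum_range_succ]
  have hlow : ∑ j ∈ range w, f j * B ^ j < B ^ w := poly_lt hB f hf w
  have hhigh : ∑ x ∈ range m, f (w + 1 + x) * B ^ (w + 1 + x) = B ^ w * (B * ∑ x ∈ range m, f (w + 1 + x) * B ^ x) := by
    rw [mul_sum, mul_sum]; refine sum_congr rfl fun x _ => by ring
  rw [hhigh, show ∑ j ∈ range w, f j * B ^ j + f w * B ^ w + B ^ w * (B * ∑ x ∈ range m, f (w + 1 + x) * B ^ x) =
      ∑ j ∈ range w, f j * B ^ j + B ^ w * (f w + B * ∑ x ∈ range m, f (w + 1 + x) * B ^ x) by ring,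
    Nat.add_mul_div_left _ _ (Nat.pow_pos hB), Nat.div_eq_of_lt hlow, Nat.zero_add, Nat.add_mul_mod_self_left,
    Nat.mod_eq_of_lt (hf w)]

/-! ## The specification -/

/-- **THE DP COUNTS THE KERNEL WORDS BY WEIGHT**: for `n < 64` slots, columns below `2^d`, and `w ≤ W`,
`dpCount col n d W w = #{u < 2^n : ⊕_{i∈u} col i = 0, |u| = w}`. -/
theorem dpCount_eq_card (col : ℕ → ℕ) {n d W w : ℕ} (hn : n < 64) (hcol : ∀ i, i < n → col i < 2 ^ d) (hw : w ≤ W) :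
    dpCount col n d W w = #(Xw' col n w) := by
  set B : ℕ := 2 ^ 64 with hB
  have hBpos : 0 < B := Nat.two_pow_pos 64
  set cols := (List.range n).map col with hcols
  have hlen : cols.length = n := by rw [hcols, List.length_map, List.length_range]
  have hcols' : ∀ c ∈ cols, c < 2 ^ d := by
    intro c hc
    rw [hcols, List.mem_map] at hc
    obtain ⟨i, hi, rfl⟩ := hc
    exact hcol i (List.mem_range.1 hi)
  -- leaf 0 = packed polynomial (mod B^(W+1), but it is below anyway)
  have hget := ((get_dpRun (B := B) (by rw [hB]; norm_num) W d cols 0 hcols').2 (Nat.two_pow_pos d))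
  -- the digits are the counts, each < B
  have hdig : ∀ j, cntR cols.reverse 0 j < B := by
    intro j
    rw [cntR_eq_card]
    calc #((range (2 ^ cols.length)).filter fun u => lsyn cols u = 0 ∧ popc cols.length u = j)
        ≤ #(range (2 ^ cols.length)) := card_filter_le _ _
      _ = 2 ^ n := by rw [card_range, hlen]
      _ < B := Nat.pow_lt_pow_right (by norm_num) hn
  have hlt : poly B W cols.reverse 0 < B ^ (W + 1) := poly_lt hBpos _ hdig (W + 1)
  unfold dpCount
  rw [← hB, ← hcols, hget, Nat.mod_eq_of_lt hlt, poly, field_poly hBpos _ hdig (Nat.lt_succ_of_le hw), cntR_eq_card,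
    hlen]
  unfold Xw'
  congr 1
  refine filter_congr fun u _ => ?_
  rw [hcols, lsyn_range_map]

end Summit.Ventures.QEC.CircuitDistance.ETower
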